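import Mathlib
import HarnessLib
import Literature.Analysis.FluidPDE.TypeIAncientMildClassical
import Literature.Analysis.FluidPDE.ClassicalLocalEnergyCutoff
import Literature.Analysis.FluidPDE.SpaceTimeMollifier
import Summits.NavierStokesRegularity.NavierStokesRegularity.Theorems.SymmetryModuliCountFarPastLedgerPinningTools

/-!
# Route SymmetryModuliCount — crux `FarPastLedger` (stmt-NavierStokesRegularity-14060),
  line `uloc-gronwall-transplant`, stub PIN `stub_fplPinning`: the affine pressure mode vanishes

Theorems file serving the crux item stmt-NavierStokesRegularity-14060
(`Summit.NavierStokesRegularity.NavierStokesRegularity.Theses.SymmetryModuliCount.FarPastLedger`),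
line `uloc-gronwall-transplant`, registered stub `stub_fplPinning` (PIN).

Let `u ∈ A_C` (`IsTypeIAncientMild C u`) with a classical pressure `p` on the window
`S = (t₀, 0)` (`IsClassicalNSSolutionOn S 1 0 u p`), let `θ` be Mathlib's bump at the origin with
radii `1, 2`, `θ_r = θ(·/r)`, `m_r = ∫ θ_r = r³ ∫ θ`. Suppose the scale-`r` bump averages
`A_r(τ) = m_r⁻¹ ∫ θ_r ∇p(τ)` converge to `a(τ)` at rate `κ(τ)/r`, `κ` bounded on compact
sub-windows, and the bump-averaged displacement `r⁻³ ∫ θ_r (u(t₂) − u(t₁))` vanishes as `r → ∞`.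
Then `a ≡ 0` on `S`.

## Proof

1. `a` is continuous on `S`: each `A_r` is continuous (parametric integral of the jointly
   continuous `θ_r ∇p` over the compact support of `θ_r`), and `A_r → a` locally uniformly.
2. For `[t₁, t₂] ⊆ S`: pair the momentum equation `∇p = Δu − (u·∇)u − ∂ₜu` with `θ_r` and
   integrate by parts onto the bump: `∫ θ_r Δu = ∫ (Δθ_r) u = O(M r)`,
   `∫ θ_r (u·∇)u = −∫ (∇θ_r·u) u = O(M² r²)` (`div u = 0`), while
   `∫_{t₁}^{t₂} ∫ θ_r ∂ₜu = ∫ θ_r (u(t₂) − u(t₁))` (differentiation under the integral sign and the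
   fundamental theorem of calculus). Dividing by `m_r = r³ ∫ θ` and letting `r → ∞` gives
   `∫_{t₁}^{t₂} a = 0`.
3. A continuous function all of whose interval integrals vanish is zero.

No published source is followed (elementary bookkeeping around the tree's whole-space
integration-by-parts identities `integral_inner_laplacian_comm`,
`integral_inner_convect_add_eq_zero` and the parametric-integral lemmas of `SpaceTimeCalculus`).
The scaled-bump facts, the vector-valued integration-by-parts identities and the time-integration
lemmas are in the companion tools file `SymmetryModuliCountFarPastLedgerPinningTools`.
-/

noncomputable section

open MeasureTheory Set Filter Metric Function
open _root_.Topology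
open scoped Laplacian RealInnerProductSpace ContDiff
open Literature.Analysis.FluidPDE

-- the summit and its single sub-problem share the name (CONVENTIONS §1), as in every Theorems file
set_option linter.dupNamespace false -- nested layout Summit.<S>.<Sub>, Sub = S (D-0017)

namespace Summit.NavierStokesRegularity.NavierStokesRegularity.Theorems

/-! ### Real-variable lemmas: uniform limits, vanishing interval integrals, bookkeeping -/

section RealVariable

variable {F : Type*} [NormedAddCommGroup F]

/-- **Continuity from a locally uniform rate.** If continuous `A r` approximate `a` on `S` with
`‖A r − a‖ ≤ κ/r`, `κ` locally bounded on `S`, then `a` is continuous on `S`. [folklore] -/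
theorem fpl_PIN_continuousOn_of_rate {S : Set ℝ} {A : ℝ → ℝ → F} {a : ℝ → F} {κ : ℝ → ℝ}
    (hA : ∀ r : ℝ, 1 ≤ r → ContinuousOn (A r) S)
    (hrate : ∀ τ ∈ S, ∀ r : ℝ, 1 ≤ r → ‖A r τ - a τ‖ ≤ κ τ / r)
    (hκ : ∀ τ ∈ S, ∃ K : ℝ, ∀ᶠ σ in 𝓝[S] τ, κ σ ≤ K) :
    ContinuousOn a S := by
  have hloc : TendstoLocallyUniformlyOn A a atTop S := by
    refine Metric.tendstoLocallyUniformlyOn_iff.2 fun ε hε τ hτ => ?_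
    obtain ⟨K, hK⟩ := hκ τ hτ
    refine ⟨{σ | κ σ ≤ K} ∩ S, inter_mem hK self_mem_nhdsWithin, ?_⟩
    filter_upwards [eventually_ge_atTop (1 : ℝ), eventually_gt_atTop (K / ε)] with r hr1 hr2 σ hσ
    have hr0 : 0 < r := by linarith
    rw [dist_eq_norm, norm_sub_rev]
    rw [div_lt_iff₀ hε] at hr2
    calc ‖A r σ - a σ‖ ≤ κ σ / r := hrate σ hσ.2 r hr1
      _ ≤ K / r := div_le_div_of_nonneg_right hσ.1 hr0.le
      _ < ε := by rw [div_lt_iff₀ hr0]; linarith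
  exact hloc.continuousOn (((eventually_ge_atTop (1 : ℝ)).mono fun r hr => hA r hr).frequently)

variable [NormedSpace ℝ F] [CompleteSpace F]

/-- **A continuous function with vanishing interval integrals vanishes**: if `a` is continuous on
an open `S` and `∫_{t₁}^{t₂} a = 0` whenever `[t₁, t₂] ⊆ S`, then `a = 0` on `S`. [folklore] -/
theorem fpl_PIN_eq_zero_of_intervalIntegral_eq_zero {S : Set ℝ} (hS : IsOpen S) {a : ℝ → F}
    (ha : ContinuousOn a S)
    (hint : ∀ t₁ t₂ : ℝ, t₁ < t₂ → Icc t₁ t₂ ⊆ S → ∫ τ in t₁..t₂, a τ = 0) {τ : ℝ}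
    (hτ : τ ∈ S) : a τ = 0 := by
  rw [← norm_le_zero_iff]
  refine le_of_forall_pos_le_add fun ε hε => ?_
  rw [zero_add]
  have hcont : ContinuousAt a τ := ha.continuousAt (hS.mem_nhds hτ)
  obtain ⟨δ, hδ, hδε⟩ := Metric.continuousAt_iff.1 hcont ε hε
  obtain ⟨δ', hδ', hball⟩ := Metric.isOpen_iff.1 hS τ hτ
  set d : ℝ := min δ δ' / 2 with hd
  have hd0 : 0 < d := by rw [hd]; positivity
  have hdδ : d < δ := by
    rw [hd]; linarith [min_le_left δ δ']
  have hdδ' : d < δ' := by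
    rw [hd]; linarith [min_le_right δ δ']
  have hI : Icc τ (τ + d) ⊆ S := fun σ hσ => hball <| by
    rw [Metric.mem_ball, Real.dist_eq, abs_lt]
    constructor <;> linarith [hσ.1, hσ.2]
  have h0 := hint τ (τ + d) (by linarith) hI
  have ia : IntervalIntegrable a volume τ (τ + d) := by
    refine (ha.mono ?_).intervalIntegrable
    rw [uIcc_of_le (by linarith)]
    exact hI
  have e : ∫ σ in τ..(τ + d), (a σ - a τ) = -(d • a τ) := by
    rw [intervalIntegral.integral_sub ia intervalIntegrable_const, h0,
      intervalIntegral.integral_const,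
      zero_sub, add_sub_cancel_left]
  have hle : ‖∫ σ in τ..(τ + d), (a σ - a τ)‖ ≤ ε * |τ + d - τ| := by
    refine intervalIntegral.norm_integral_le_of_norm_le_const fun σ hσ => ?_
    rw [uIoc_of_le (by linarith)] at hσ
    rw [← dist_eq_norm]
    refine (hδε ?_).le
    rw [Real.dist_eq, abs_lt]
    constructor <;> linarith [hσ.1, hσ.2]
  rw [e, norm_neg, norm_smul, Real.norm_of_nonneg hd0.le, add_sub_cancel_left,
    abs_of_pos hd0, mul_comm] at hle
  exact le_of_mul_le_mul_right hle hd0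

omit [CompleteSpace F] in
/-- **Bookkeeping for the pinning estimate**: if on `[t₁, t₂]` `‖a − A‖ ≤ ρ` and
`‖A + c D‖ ≤ β`, then `‖∫ a‖ ≤ |t₂ − t₁| ρ + |t₂ − t₁| β + ‖c ∫ D‖`. [folklore] -/
theorem fpl_PIN_norm_intervalIntegral_le_of_split {a A D : ℝ → F} {t₁ t₂ : ℝ} (h12 : t₁ ≤ t₂)
    (ia : IntervalIntegrable a volume t₁ t₂) (iA : IntervalIntegrable A volume t₁ t₂)
    (iD : IntervalIntegrable D volume t₁ t₂) (c : ℝ) {ρ β : ℝ}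
    (hρ : ∀ s ∈ Icc t₁ t₂, ‖a s - A s‖ ≤ ρ) (hβ : ∀ s ∈ Icc t₁ t₂, ‖A s + c • D s‖ ≤ β) :
    ‖∫ s in t₁..t₂, a s‖ ≤
      |t₂ - t₁| * ρ + |t₂ - t₁| * β + ‖c • ∫ s in t₁..t₂, D s‖ := by
  have iD' : IntervalIntegrable (fun s => c • D s) volume t₁ t₂ := iD.smul c
  have i1 : IntervalIntegrable (fun s => a s - A s) volume t₁ t₂ := ia.sub iA
  have i2 : IntervalIntegrable (fun s => A s + c • D s) volume t₁ t₂ := iA.add iD'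
  have e : ∫ s in t₁..t₂, a s = (∫ s in t₁..t₂, (a s - A s)) + (∫ s in t₁..t₂, (A s + c • D s)) -
      c • ∫ s in t₁..t₂, D s := by
    rw [← intervalIntegral.integral_smul, ← intervalIntegral.integral_add i1 i2,
      ← intervalIntegral.integral_sub (i1.add i2) iD']
    refine intervalIntegral.integral_congr fun s _ => ?_
    abel
  have hIoc : uIoc t₁ t₂ ⊆ Icc t₁ t₂ := by
    rw [uIoc_of_le h12]
    exact Ioc_subset_Icc_self
  have b1 : ‖∫ s in t₁..t₂, (a s - A s)‖ ≤ ρ * |t₂ - t₁| :=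
    intervalIntegral.norm_integral_le_of_norm_le_const fun s hs => hρ s (hIoc hs)
  have b2 : ‖∫ s in t₁..t₂, (A s + c • D s)‖ ≤ β * |t₂ - t₁| :=
    intervalIntegral.norm_integral_le_of_norm_le_const fun s hs => hβ s (hIoc hs)
  rw [e]
  refine (norm_sub_le _ _).trans (add_le_add ((norm_add_le _ _).trans (add_le_add ?_ ?_)) le_rfl)
  · rw [mul_comm]; exact b1
  · rw [mul_comm]; exact b2

end RealVariable

/-! ### The pinning estimate at a fixed scale, the limit `r → ∞`, and the registered stub -/

section Main

/-- **The pinning estimate at scale `r ≥ 1`.** For a classical solution `(u, p)` of the unforced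
unit-viscosity system on the window `(t₀, 0)` with `‖u‖ ≤ M` on `[t₁, t₂] ⊆ (t₀, 0)`, and `a`
continuous on the window with `‖m_r⁻¹ ∫ θ_r ∇p(τ) − a(τ)‖ ≤ K/r` on `[t₁, t₂]`:
`‖∫_{t₁}^{t₂} a‖ ≤ |t₂−t₁| K/r + |t₂−t₁| (M ‖Δθ‖₁ r⁻² + M² ‖Dθ‖₁ r⁻¹)/∫θ`
`+ ‖r⁻³ ∫ θ_r (u(t₂) − u(t₁))‖/∫θ` (pair the momentum equation with `θ_r`, integrate by parts
onto the bump, integrate in time). [folklore] -/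
theorem fpl_PIN_norm_intervalIntegral_le (θ : ContDiffBump (0 : EuclideanSpace ℝ (Fin 3))) {t₀ : ℝ}
    {u : ℝ → EuclideanSpace ℝ (Fin 3) → EuclideanSpace ℝ (Fin 3)}
    {p : ℝ → EuclideanSpace ℝ (Fin 3) → ℝ} (hp : IsClassicalNSSolutionOn (Ioo t₀ 0) 1 0 u p)
    {a : ℝ → EuclideanSpace ℝ (Fin 3)} (ha : ContinuousOn a (Ioo t₀ 0)) {t₁ t₂ : ℝ} (h₁ : t₀ < t₁)
    (h12 : t₁ ≤ t₂) (h₂ : t₂ < 0) {K : ℝ} {r : ℝ} (hr : 1 ≤ r)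
    (hrate : ∀ τ ∈ Icc t₁ t₂,
      ‖(∫ x, θ (r⁻¹ • x))⁻¹ • (∫ x, θ (r⁻¹ • x) • gradient (p τ) x) - a τ‖ ≤ K / r)
    {M : ℝ} (hM0 : 0 ≤ M) (hM : ∀ τ ∈ Icc t₁ t₂, ∀ x, ‖u τ x‖ ≤ M) :
    ‖∫ τ in t₁..t₂, a τ‖ ≤
      |t₂ - t₁| * (K * r⁻¹) +
        |t₂ - t₁| * ((∫ x, θ x)⁻¹ * (M * (∫ x, |(Δ ⇑θ) x|) * (r⁻¹ * r⁻¹) +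
          M ^ 2 * (∫ x, ‖fderiv ℝ θ x‖) * r⁻¹)) +
        (∫ x, θ x)⁻¹ * ‖(r ^ 3)⁻¹ • ∫ x, θ (r⁻¹ • x) • (u t₂ x - u t₁ x)‖ := by
  set S : Set ℝ := Ioo t₀ 0 with hSdef
  have hS : IsOpen S := isOpen_Ioo
  have hI : Icc t₁ t₂ ⊆ S := fun τ hτ => ⟨h₁.trans_le hτ.1, hτ.2.trans_lt h₂⟩
  have hI' : uIcc t₁ t₂ ⊆ S := by rw [uIcc_of_le h12]; exact hI
  have hr0 : 0 < r := by linarith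
  -- the scaled bump
  have hθrtop : ContDiff ℝ ∞ fun x => θ (r⁻¹ • x) := fpl_PIN_contDiff_scaled θ r
  have hθr2 : ContDiff ℝ 2 fun x => θ (r⁻¹ • x) := fpl_PIN_contDiff_scaled θ r
  have hθr1 : ContDiff ℝ 1 fun x => θ (r⁻¹ • x) := fpl_PIN_contDiff_scaled θ r
  have hθrc : HasCompactSupport fun x => θ (r⁻¹ • x) := fpl_PIN_hasCompactSupport_scaled θ hr0
  have hθrcont : Continuous fun x => θ (r⁻¹ • x) := hθr1.continuous
  have hm₁ : 0 < ∫ x, θ x := θ.integral_pos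
  have hmr : ∫ x, θ (r⁻¹ • x) = r ^ 3 * ∫ x, θ x := fpl_PIN_integral_scaled θ hr0
  have hmr0 : 0 < r ^ 3 * ∫ x, θ x := by positivity
  -- interval integrability of the three functions of time
  have hPc : ContinuousOn (fun s => ∫ x, θ (r⁻¹ • x) • gradient (p s) x) S :=
    fpl_PIN_continuousOn_integral_smul_gradient hp hS.uniqueDiffOn hθrcont hθrc
  have hDc : ContinuousOn (fun s => ∫ x, θ (r⁻¹ • x) • timeDerivWithin S u s x) S :=
    fpl_PIN_continuousOn_integral_smul_timeDeriv hp hS.uniqueDiffOn hθrcont hθrc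
  have ia : IntervalIntegrable a volume t₁ t₂ := (ha.mono hI').intervalIntegrable
  have hconst : ContinuousOn (fun _ : ℝ => (r ^ 3 * ∫ x, θ x)⁻¹) S := continuousOn_const
  have iA : IntervalIntegrable (fun s => (r ^ 3 * ∫ x, θ x)⁻¹ • ∫ x, θ (r⁻¹ • x) • gradient (p s) x)
      volume t₁ t₂ := ((hconst.smul hPc).mono hI').intervalIntegrable
  have iD : IntervalIntegrable (fun s => ∫ x, θ (r⁻¹ • x) • timeDerivWithin S u s x)
      volume t₁ t₂ := (hDc.mono hI').intervalIntegrable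
  -- the rate on `[t₁, t₂]`
  have hρ : ∀ s ∈ Icc t₁ t₂,
      ‖a s - (r ^ 3 * ∫ x, θ x)⁻¹ • ∫ x, θ (r⁻¹ • x) • gradient (p s) x‖ ≤ K * r⁻¹ := by
    intro s hs
    rw [norm_sub_rev, ← hmr, ← div_eq_mul_inv]
    exact hrate s hs
  -- the slice estimate: viscous and transport terms integrated by parts onto the bump
  have hβ : ∀ s ∈ Icc t₁ t₂,
      ‖(r ^ 3 * ∫ x, θ x)⁻¹ • (∫ x, θ (r⁻¹ • x) • gradient (p s) x) +
          (r ^ 3 * ∫ x, θ x)⁻¹ • ∫ x, θ (r⁻¹ • x) • timeDerivWithin S u s x‖ ≤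
        (r ^ 3 * ∫ x, θ x)⁻¹ *
          (M * (r * ∫ x, |(Δ ⇑θ) x|) + M ^ 2 * (r ^ 2 * ∫ x, ‖fderiv ℝ θ x‖)) := by
    intro s hs
    have hsS : s ∈ S := hI hs
    have hu2 : ContDiff ℝ 2 (u s) := (hp.contDiff_velocity hsS).of_le (by norm_cast)
    have hu1 : ContDiff ℝ 1 (u s) := (hp.contDiff_velocity hsS).of_le (by norm_cast)
    have e := fpl_PIN_integral_smul_gradient_add hp hS.uniqueDiffOn hsS hθrcont hθrc
    rw [one_smul ℝ, fpl_PIN_integral_smul_laplacian hθr2 hθrc hu2,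
      fpl_PIN_integral_smul_convect hθr1 hθrc hu1 (hp.divFree s hsS), sub_neg_eq_add] at e
    -- the viscous term `∫ (Δθ_r) u`
    have hg1 : Integrable (fun x => |(Δ (fun y => θ (r⁻¹ • y))) x| * M)
        volume := by
      refine ((continuous_laplacian hθr2).abs.mul continuous_const).integrable_of_hasCompactSupport
        (HasCompactSupport.intro hθrc fun x hx => ?_)
      show |(Δ (fun y => θ (r⁻¹ • y))) x| * M = 0
      rw [laplacian_eq_zero_of_notMem_tsupport hx, abs_zero, zero_mul]
    have hpt1 : ∀ x, ‖(Δ (fun y => θ (r⁻¹ • y))) x • u s x‖ ≤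
        |(Δ (fun y => θ (r⁻¹ • y))) x| * M := fun x => by
      rw [norm_smul, Real.norm_eq_abs]
      exact mul_le_mul_of_nonneg_left (hM s hs x) (abs_nonneg _)
    have hvis : ‖∫ x, (Δ (fun y => θ (r⁻¹ • y))) x • u s x‖ ≤
        M * (r * ∫ x, |(Δ ⇑θ) x|) := by
      refine (norm_integral_le_of_norm_le hg1 (Eventually.of_forall hpt1)).trans (le_of_eq ?_)
      rw [integral_mul_const, fpl_PIN_integral_abs_laplacian_scaled θ hr0]
      ring
    -- the transport term `∫ (Dθ_r u) u`
    have hg2 : Integrable (fun x => ‖fderiv ℝ (fun y => θ (r⁻¹ • y)) x‖ * M ^ 2)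
        volume := by
      refine (((hθr1.continuous_fderiv one_ne_zero).norm).mul continuous_const)
        |>.integrable_of_hasCompactSupport (HasCompactSupport.intro (hθrc.fderiv (𝕜 := ℝ))
          fun x hx => ?_)
      show ‖fderiv ℝ (fun y => θ (r⁻¹ • y)) x‖ * M ^ 2 = 0
      rw [image_eq_zero_of_notMem_tsupport hx, norm_zero, zero_mul]
    have hpt2 : ∀ x, ‖(fderiv ℝ (fun y => θ (r⁻¹ • y)) x (u s x)) • u s x‖ ≤
        ‖fderiv ℝ (fun y => θ (r⁻¹ • y)) x‖ * M ^ 2 := fun x => by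
      rw [norm_smul]
      calc ‖fderiv ℝ (fun y => θ (r⁻¹ • y)) x (u s x)‖ * ‖u s x‖
          ≤ (‖fderiv ℝ (fun y => θ (r⁻¹ • y)) x‖ * ‖u s x‖) * ‖u s x‖ :=
            mul_le_mul_of_nonneg_right (ContinuousLinearMap.le_opNorm _ _) (norm_nonneg _)
        _ ≤ (‖fderiv ℝ (fun y => θ (r⁻¹ • y)) x‖ * M) * M :=
            mul_le_mul (mul_le_mul_of_nonneg_left (hM s hs x) (norm_nonneg _)) (hM s hs x)
              (norm_nonneg _) (mul_nonneg (norm_nonneg _) hM0)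
        _ = ‖fderiv ℝ (fun y => θ (r⁻¹ • y)) x‖ * M ^ 2 := by ring
    have htra : ‖∫ x, (fderiv ℝ (fun y => θ (r⁻¹ • y)) x (u s x)) • u s x‖ ≤
        M ^ 2 * (r ^ 2 * ∫ x, ‖fderiv ℝ θ x‖) := by
      refine (norm_integral_le_of_norm_le hg2 (Eventually.of_forall hpt2)).trans (le_of_eq ?_)
      rw [integral_mul_const, fpl_PIN_integral_norm_fderiv_scaled θ hr0]
      ring
    rw [← smul_add, e, norm_smul, norm_inv, Real.norm_of_nonneg hmr0.le]
    exact mul_le_mul_of_nonneg_left ((norm_add_le _ _).trans (add_le_add hvis htra))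
      (inv_nonneg.2 hmr0.le)
  -- bookkeeping and the fundamental theorem of calculus for the time-derivative term
  have key := fpl_PIN_norm_intervalIntegral_le_of_split h12 ia iA iD ((r ^ 3 * ∫ x, θ x)⁻¹) hρ hβ
  rw [fpl_PIN_intervalIntegral_integral_smul_timeDeriv hp hS hθrtop hθrc h12 hI] at key
  refine key.trans (le_of_eq ?_)
  have e1 : (r ^ 3 * ∫ x, θ x)⁻¹ *
        (M * (r * ∫ x, |(Δ ⇑θ) x|) + M ^ 2 * (r ^ 2 * ∫ x, ‖fderiv ℝ θ x‖)) =
      (∫ x, θ x)⁻¹ * (M * (∫ x, |(Δ ⇑θ) x|) * (r⁻¹ * r⁻¹) +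
        M ^ 2 * (∫ x, ‖fderiv ℝ θ x‖) * r⁻¹) := by
    field_simp
  have e2 : ‖(r ^ 3 * ∫ x, θ x)⁻¹ • ∫ x, θ (r⁻¹ • x) • (u t₂ x - u t₁ x)‖ =
      (∫ x, θ x)⁻¹ * ‖(r ^ 3)⁻¹ • ∫ x, θ (r⁻¹ • x) • (u t₂ x - u t₁ x)‖ := by
    rw [norm_smul, norm_smul, norm_inv, norm_inv, norm_mul, norm_pow, Real.norm_of_nonneg hr0.le,
      Real.norm_of_nonneg hm₁.le]
    ring
  rw [e1, e2]

/-- **Vanishing of the interval integrals of the affine mode**: under the rate hypothesis and the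
mean-displacement hypothesis, `∫_{t₁}^{t₂} a = 0` for `[t₁, t₂]` inside the window (let `r → ∞`
in `fpl_PIN_norm_intervalIntegral_le`). [folklore] -/
theorem fpl_PIN_intervalIntegral_eq_zero (θ : ContDiffBump (0 : EuclideanSpace ℝ (Fin 3))) {C : ℝ}
    {u : ℝ → EuclideanSpace ℝ (Fin 3) → EuclideanSpace ℝ (Fin 3)} (hu : IsTypeIAncientMild C u)
    {t₀ : ℝ} {p : ℝ → EuclideanSpace ℝ (Fin 3) → ℝ}
    (hp : IsClassicalNSSolutionOn (Ioo t₀ 0) 1 0 u p) {a : ℝ → EuclideanSpace ℝ (Fin 3)} {κ : ℝ → ℝ}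
    (hrate : ∀ τ ∈ Ioo t₀ 0, ∀ r : ℝ, 1 ≤ r →
      ‖(∫ x, θ (r⁻¹ • x))⁻¹ • (∫ x, θ (r⁻¹ • x) • gradient (p τ) x) - a τ‖ ≤ κ τ / r)
    (hκ : ∀ τ₁ τ₂ : ℝ, t₀ < τ₁ → τ₂ < 0 → ∃ K : ℝ, ∀ τ ∈ Icc τ₁ τ₂, κ τ ≤ K)
    (hMD : ∀ t₁ t₂ : ℝ, t₁ < t₂ → t₂ < 0 →
      Tendsto (fun r : ℝ => (r ^ 3)⁻¹ • ∫ x, θ (r⁻¹ • x) • (u t₂ x - u t₁ x)) atTop (𝓝 0))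
    (ha : ContinuousOn a (Ioo t₀ 0)) {t₁ t₂ : ℝ} (h₁ : t₀ < t₁) (h12 : t₁ < t₂) (h₂ : t₂ < 0) :
    ∫ τ in t₁..t₂, a τ = 0 := by
  obtain ⟨K, hK⟩ := hκ t₁ t₂ h₁ h₂
  -- velocity bound on `[t₁, t₂]` from the Type I rate
  set M : ℝ := C / Real.sqrt (-(t₂ / 2)) with hMdef
  have hM : ∀ τ ∈ Icc t₁ t₂, ∀ x, ‖u τ x‖ ≤ M := fun τ hτ x =>
    hu.norm_le_of_mem_Ioo (s := t₁ - 1) (by linarith) ⟨by linarith [hτ.1], by linarith [hτ.2]⟩ x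
  have hM0 : 0 ≤ M := (norm_nonneg _).trans (hM t₁ (left_mem_Icc.2 h12.le) 0)
  have key : ∀ r : ℝ, 1 ≤ r → ‖∫ τ in t₁..t₂, a τ‖ ≤
      |t₂ - t₁| * (K * r⁻¹) +
        |t₂ - t₁| * ((∫ x, θ x)⁻¹ * (M * (∫ x, |(Δ ⇑θ) x|) * (r⁻¹ * r⁻¹) +
          M ^ 2 * (∫ x, ‖fderiv ℝ θ x‖) * r⁻¹)) +
        (∫ x, θ x)⁻¹ * ‖(r ^ 3)⁻¹ • ∫ x, θ (r⁻¹ • x) • (u t₂ x - u t₁ x)‖ := by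
    intro r hr
    have hr0 : 0 < r := by linarith
    refine fpl_PIN_norm_intervalIntegral_le θ hp ha h₁ h12.le h₂ hr (fun τ hτ => ?_) hM0 hM
    refine (hrate τ ⟨h₁.trans_le hτ.1, hτ.2.trans_lt h₂⟩ r hr).trans ?_
    exact div_le_div_of_nonneg_right (hK τ hτ) hr0.le
  have hlim : Tendsto (fun r : ℝ => |t₂ - t₁| * (K * r⁻¹) +
        |t₂ - t₁| * ((∫ x, θ x)⁻¹ * (M * (∫ x, |(Δ ⇑θ) x|) * (r⁻¹ * r⁻¹) +
          M ^ 2 * (∫ x, ‖fderiv ℝ θ x‖) * r⁻¹)) +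
        (∫ x, θ x)⁻¹ * ‖(r ^ 3)⁻¹ • ∫ x, θ (r⁻¹ • x) • (u t₂ x - u t₁ x)‖) atTop (𝓝 0) := by
    have h1 : Tendsto (fun r : ℝ => r⁻¹) atTop (𝓝 0) := tendsto_inv_atTop_zero
    have h2 := (hMD t₁ t₂ h12 h₂).norm
    have h3 := (((h1.const_mul K).const_mul |t₂ - t₁|).add
      (((((h1.mul h1).const_mul (M * ∫ x, |(Δ ⇑θ) x|)).add
        (h1.const_mul (M ^ 2 * ∫ x, ‖fderiv ℝ θ x‖))).const_mul
        (∫ x, θ x)⁻¹).const_mul |t₂ - t₁|)).add (h2.const_mul (∫ x, θ x)⁻¹)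
    simpa using h3
  have hle : ‖∫ τ in t₁..t₂, a τ‖ ≤ 0 :=
    ge_of_tendsto hlim ((eventually_ge_atTop 1).mono fun r hr => key r hr)
  exact norm_le_zero_iff.1 hle

/-- **Continuity of the affine mode on the window** (uniform limit of the continuous bump
averages of `∇p`). [folklore] -/
theorem fpl_PIN_continuousOn_mode (θ : ContDiffBump (0 : EuclideanSpace ℝ (Fin 3))) {t₀ : ℝ}
    {u : ℝ → EuclideanSpace ℝ (Fin 3) → EuclideanSpace ℝ (Fin 3)}
    {p : ℝ → EuclideanSpace ℝ (Fin 3) → ℝ} (hp : IsClassicalNSSolutionOn (Ioo t₀ 0) 1 0 u p)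
    {a : ℝ → EuclideanSpace ℝ (Fin 3)} {κ : ℝ → ℝ}
    (hrate : ∀ τ ∈ Ioo t₀ 0, ∀ r : ℝ, 1 ≤ r →
      ‖(∫ x, θ (r⁻¹ • x))⁻¹ • (∫ x, θ (r⁻¹ • x) • gradient (p τ) x) - a τ‖ ≤ κ τ / r)
    (hκ : ∀ τ₁ τ₂ : ℝ, t₀ < τ₁ → τ₂ < 0 → ∃ K : ℝ, ∀ τ ∈ Icc τ₁ τ₂, κ τ ≤ K) :
    ContinuousOn a (Ioo t₀ 0) := by
  refine fpl_PIN_continuousOn_of_rate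
    (A := fun r τ => (∫ x, θ (r⁻¹ • x))⁻¹ • ∫ x, θ (r⁻¹ • x) • gradient (p τ) x)
    (fun r hr => ?_) hrate fun τ hτ => ?_
  · have hr0 : 0 < r := by linarith
    have hθr1 : ContDiff ℝ 1 fun x => θ (r⁻¹ • x) := fpl_PIN_contDiff_scaled θ r
    have hc := fpl_PIN_continuousOn_integral_smul_gradient hp isOpen_Ioo.uniqueDiffOn
      hθr1.continuous (fpl_PIN_hasCompactSupport_scaled θ hr0)
    have hconst : ContinuousOn (fun _ : ℝ => (∫ x, θ (r⁻¹ • x))⁻¹) (Ioo t₀ 0) :=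
      continuousOn_const
    exact hconst.smul hc
  · have h1 : t₀ < (t₀ + τ) / 2 := by linarith [hτ.1]
    have h2 : τ / 2 < 0 := by linarith [hτ.2]
    obtain ⟨K, hK⟩ := hκ ((t₀ + τ) / 2) (τ / 2) h1 h2
    refine ⟨K, mem_nhdsWithin_of_mem_nhds ?_⟩
    have h3 : (t₀ + τ) / 2 < τ := by linarith [hτ.1]
    have h4 : τ < τ / 2 := by linarith [hτ.2]
    exact mem_of_superset (Icc_mem_nhds h3 h4) fun σ hσ => hK σ hσ

/-- **Stub PIN `stub_fplPinning` of line `uloc-gronwall-transplant` (crux `FarPastLedger`,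
stmt-NavierStokesRegularity-14060): the affine pressure mode vanishes.** If the scale-`r` bump
averages of `∇p(τ, ·)` converge to `a(τ)` at rate `κ(τ)/r` with `κ` bounded on compact
sub-windows, and the bump-averaged displacement of `u` vanishes at large scales, then `a ≡ 0` on
the window `(t₀, 0)`: `a` is continuous (locally uniform limit of continuous averages), its
interval integrals vanish (momentum equation averaged at scale `r → ∞`: the viscous and transport
terms are `O(r⁻²)`, `O(r⁻¹)` after integrating by parts onto the bump, the time-derivative term is
the mean displacement), and a continuous function with vanishing interval integrals is zero.
[folklore] -/
theorem stub_fplPinning :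
    ∀ (C : ℝ) (u : ℝ → EuclideanSpace ℝ (Fin 3) → EuclideanSpace ℝ (Fin 3)),
    Literature.Analysis.FluidPDE.IsTypeIAncientMild C u →
    ∀ (t₀ : ℝ) (p : ℝ → EuclideanSpace ℝ (Fin 3) → ℝ),
    Literature.Analysis.FluidPDE.IsClassicalNSSolutionOn (Set.Ioo t₀ 0) 1 0 u p →
    ∀ (a : ℝ → EuclideanSpace ℝ (Fin 3)) (κ : ℝ → ℝ),
    (∀ τ ∈ Set.Ioo t₀ 0, ∀ r : ℝ, 1 ≤ r →
      ‖(∫ x, ((⟨1, 2, zero_lt_one, one_lt_two⟩ : ContDiffBump (0 : EuclideanSpace ℝ (Fin 3))) :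
            EuclideanSpace ℝ (Fin 3) → ℝ) (r⁻¹ • x))⁻¹ •
          (∫ x, (((⟨1, 2, zero_lt_one, one_lt_two⟩ :
              ContDiffBump (0 : EuclideanSpace ℝ (Fin 3))) : EuclideanSpace ℝ (Fin 3) → ℝ)
                (r⁻¹ • x)) • gradient (p τ) x) - a τ‖ ≤ κ τ / r) →
    (∀ τ₁ τ₂ : ℝ, t₀ < τ₁ → τ₂ < 0 → ∃ K : ℝ, ∀ τ ∈ Set.Icc τ₁ τ₂, κ τ ≤ K) →
    (∀ t₁ t₂ : ℝ, t₁ < t₂ → t₂ < 0 →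
      Filter.Tendsto (fun r : ℝ => (r ^ 3)⁻¹ •
        ∫ x, (((⟨1, 2, zero_lt_one, one_lt_two⟩ : ContDiffBump (0 : EuclideanSpace ℝ (Fin 3))) :
            EuclideanSpace ℝ (Fin 3) → ℝ) (r⁻¹ • x)) • (u t₂ x - u t₁ x))
        Filter.atTop (nhds 0)) →
    ∀ τ ∈ Set.Ioo t₀ 0, a τ = 0 := by
  intro C u hu t₀ p hp a κ hrate hκ hMD τ hτ
  have ha : ContinuousOn a (Ioo t₀ 0) :=
    fpl_PIN_continuousOn_mode ⟨1, 2, zero_lt_one, one_lt_two⟩ hp hrate hκ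
  refine fpl_PIN_eq_zero_of_intervalIntegral_eq_zero isOpen_Ioo ha (fun t₁ t₂ h12 hI => ?_) hτ
  have h₁ : t₀ < t₁ := (hI (left_mem_Icc.2 h12.le)).1
  have h₂ : t₂ < 0 := (hI (right_mem_Icc.2 h12.le)).2
  exact fpl_PIN_intervalIntegral_eq_zero ⟨1, 2, zero_lt_one, one_lt_two⟩ hu hp hrate hκ hMD ha
    h₁ h12 h₂

end Main

end Summit.NavierStokesRegularity.NavierStokesRegularity.Theorems

end
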